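import Literature.MathematicalPhysics.KineticTheory.LinearLangevinGaussianMeasure
import Literature.MathematicalPhysics.KineticTheory.LangevinChainHormander
import HarnessLib

/-!
# The Gaussian non-equilibrium steady state of the harmonic chain between Langevin baths (proved)

Trunk T-KINETIC (Literature/MathematicalPhysics/KineticTheory). Fourth decomposition step for the
named fact `Literature.Barriers.AtomisticToContinuum.HarmonicChainBallisticFlux` (provefact
unit). For the harmonic member `pinnedChain ω₂ 0 0 γ` of `FouriersLaw.lean` (`ω₂, γ > 0`), every
length `N` and all bath temperatures `T_L, T_R > 0` we PROVE:

* `harmonicNESS ω₂ γ N T_L T_R` — the Gaussian probability measure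
  `Z⁻¹ exp(-½ x♭ᵀ C⁻¹ x♭) dq dp` with `C = chainCov ω₂ γ N T_L T_R` the solution of the Lyapunov
  equation `A C + C Aᵀ + Σ = 0` (`HarmonicChainCovariance.lean`) — IS a steady state in the weak
  Fokker–Planck sense `OscillatorChain.IsSteadyState` (`isSteadyState_harmonicNESS`): the formal
  adjoint polynomial `L*_B` of `LinearLangevinGaussian.lean` for `B = C⁻¹` is
  `½ x♭ᵀ(AᵀB + BA + BΣB)x♭ - ½(2 tr A + tr ΣB)`, and both brackets vanish by the Lyapunov
  equation (`adjointPoly_harmonic_eq_zero`);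
* its covariance is `C` (`integral_flat_mul_flat_harmonicNESS`), so the mean energy current of
  every bond is `⟨q_i p_{i+1}⟩ = C_{q_i p_{i+1}} = fluxCoeff ω₂ γ N · (T_L - T_R)`
  (`integral_bondCurrent_harmonicNESS`).

This is the classical statement "for quadratic `U, V` … the stationary measure is Gaussian and
one only needs to compute the covariances" (Bonetto–Lebowitz–Rey-Bellet 2000, §6.2;
Rieder–Lebowitz–Lieb 1967; Nakazawa 1970; Dhar 2008, §3.1), made rigorous in the weak sense used
by `FouriersLaw.lean`.

## References

* F. Bonetto, J. L. Lebowitz, L. Rey-Bellet, *Fourier's law: a challenge to theorists* (2000),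
  §6.2. [cite: BonettoLebowitzReyBellet2000, §6.2]
* A. Dhar, Adv. Phys. 57 (2008) 457, §3.1 (`â·B̂ + B̂·âᵀ = D̂`; Gaussian stationary state;
  `J = -⟨(Φ x)_l p_l⟩`). [cite: Dhar2008, §3.1]

## Design choices

* Everything is derived from the abstract covariance `chainCov` (existence, uniqueness,
  positivity, bond identities are in `HarmonicChainCovariance.lean`); no closed form is needed
  here. The closed form of `fluxCoeff` and its `N → ∞` limit are in `HarmonicChainFlux.lean`.
* The weak equation is obtained for `f ∈ C²_c` (the predicate asks `C_c^∞`).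
-/

noncomputable section

open MeasureTheory Matrix

namespace Literature.MathematicalPhysics.KineticTheory.HeatConduction

variable {N : ℕ}

/-! ### The harmonic chain: `∂_{q_i}H = (Φ q)_i`, `V' = id` -/

section Harmonic

variable (ω₂ γ : ℝ)

/-- `U'(q) = ω₂ q` for the harmonic pinning `U(q) = ω₂q²/2 + 0·q⁴/4`. [folklore] -/
theorem pinnedChain_harmonic_deriv_U (q : ℝ) : deriv (pinnedChain ω₂ 0 0 γ).U q = ω₂ * q := by
  show deriv (fun q => ω₂ * q ^ 2 / 2 + 0 * q ^ 4 / 4) q = _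
  have h : HasDerivAt (fun q => ω₂ * q ^ 2 / 2 + 0 * q ^ 4 / 4)
      (ω₂ * (2 * q ^ 1 * 1) / 2 + 0 * (4 * q ^ 3 * 1) / 4) q :=
    ((((hasDerivAt_id q).pow 2).const_mul ω₂).div_const 2).add
      ((((hasDerivAt_id q).pow 4).const_mul 0).div_const 4)
  rw [h.deriv]
  ring

/-- `V'(r) = r` for the harmonic coupling `V(r) = r²/2 + 0·r⁴/4`. [folklore] -/
theorem pinnedChain_harmonic_deriv_V (r : ℝ) : deriv (pinnedChain ω₂ 0 0 γ).V r = r := by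
  rw [pinnedChain_deriv_V]; ring

/-- **`∂_{q_i} H = (Φ q)_i`** for the harmonic chain: the force is linear, given by the force
matrix `Φ = ω₂ + (-Δ_free)` of `HarmonicChainCovariance.lean`. [Roy–Dhar 2008, §2 eq. (2.3)]
[folklore] -/
theorem pinnedChain_harmonic_partialQ_hamiltonian (x : PhaseSpace N) (i : Fin N) :
    partialQ i ((pinnedChain ω₂ 0 0 γ).hamiltonian N) x = (forceMatrix ω₂ N *ᵥ x.1) i := by
  have hU : Differentiable ℝ (pinnedChain ω₂ 0 0 γ).U :=
    (pinnedChain_contDiff_U ω₂ 0 0 γ (n := 1)).differentiable one_ne_zero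
  have hV : Differentiable ℝ (pinnedChain ω₂ 0 0 γ).V :=
    (pinnedChain_contDiff_V ω₂ 0 0 γ (n := 1)).differentiable one_ne_zero
  rw [(pinnedChain ω₂ 0 0 γ).partialQ_hamiltonian_eq_dPotential hU hV, OscillatorChain.dPotential,
    forceMatrix_mulVec_apply, pinnedChain_harmonic_deriv_U]
  congr 1
  refine Finset.sum_congr rfl fun k _ => Finset.sum_congr rfl fun l _ => ?_
  by_cases h : l.val = k.val + 1
  · rw [if_pos h, if_pos h, pinnedChain_harmonic_deriv_V]; ring
  · rw [if_neg h, if_neg h]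

/-- The bath coupling constant of `pinnedChain ω₂ lam β γ` is `γ`. [folklore] -/
@[simp] theorem pinnedChain_γ (lam β : ℝ) : (pinnedChain ω₂ lam β γ).γ = γ := rfl

end Harmonic

/-- `x♭ ∘ inl = q`. [folklore] -/
@[simp] theorem flat_comp_inl (x : PhaseSpace N) : flat x ∘ Sum.inl = x.1 := rfl

/-- `x♭ ∘ inr = p`. [folklore] -/
@[simp] theorem flat_comp_inr (x : PhaseSpace N) : flat x ∘ Sum.inr = x.2 := rfl

/-! ### The adjoint polynomial in matrix form, and its vanishing from the Lyapunov equation -/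

section Algebra

variable {ι : Type*} [Fintype ι] [DecidableEq ι]

omit [DecidableEq ι] in
/-- `(M v) ⬝ w = v ⬝ (Mᵀ w)`. [folklore] -/
theorem mulVec_dotProduct_eq (M : Matrix ι ι ℝ) (v w : ι → ℝ) :
    (M *ᵥ v) ⬝ᵥ w = v ⬝ᵥ (Mᵀ *ᵥ w) := by
  rw [dotProduct_mulVec v Mᵀ w, vecMul_transpose]

omit [DecidableEq ι] in
/-- The quadratic form of `M` equals that of `Mᵀ`. [folklore] -/
theorem dotProduct_mulVec_transpose (M : Matrix ι ι ℝ) (v : ι → ℝ) :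
    v ⬝ᵥ (Mᵀ *ᵥ v) = v ⬝ᵥ (M *ᵥ v) := by
  rw [← mulVec_dotProduct_eq, dotProduct_comm]

omit [DecidableEq ι] in
/-- **The Lyapunov algebra behind `L* ρ = 0`.** If `B` is symmetric and
`AᵀB + BA + BΣB = 0`, `2 tr A + tr(ΣB) = 0`, then for every `v`
`(Av)⬝(Bv) - tr A - tr(ΣB)/2 + (Bv)⬝(Σ(Bv))/2 = 0`
(the left side is `½ vᵀ(AᵀB + BA + BΣB)v - ½(2 tr A + tr ΣB)`). [folklore] -/
theorem lyapunov_adjoint_form_eq_zero {A Q B : Matrix ι ι ℝ} (hBt : Bᵀ = B)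
    (h1 : Aᵀ * B + B * A + B * Q * B = 0) (h2 : 2 * A.trace + (Q * B).trace = 0) (v : ι → ℝ) :
    (A *ᵥ v) ⬝ᵥ (B *ᵥ v) - A.trace - (Q * B).trace / 2 + (B *ᵥ v) ⬝ᵥ (Q *ᵥ (B *ᵥ v)) / 2 = 0 := by
  have e1 : (A *ᵥ v) ⬝ᵥ (B *ᵥ v) = v ⬝ᵥ ((Aᵀ * B) *ᵥ v) := by
    rw [mulVec_dotProduct_eq, mulVec_mulVec]
  have e2 : (B *ᵥ v) ⬝ᵥ (Q *ᵥ (B *ᵥ v)) = v ⬝ᵥ ((B * Q * B) *ᵥ v) := by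
    rw [mulVec_dotProduct_eq, hBt]
    simp only [mulVec_mulVec, Matrix.mul_assoc]
  have e3 : v ⬝ᵥ ((B * A) *ᵥ v) = v ⬝ᵥ ((Aᵀ * B) *ᵥ v) := by
    rw [← dotProduct_mulVec_transpose (B * A), transpose_mul, hBt]
  have e4 : v ⬝ᵥ ((Aᵀ * B + B * A + B * Q * B) *ᵥ v) =
      2 * (v ⬝ᵥ ((Aᵀ * B) *ᵥ v)) + v ⬝ᵥ ((B * Q * B) *ᵥ v) := by
    rw [add_mulVec, add_mulVec, dotProduct_add, dotProduct_add, e3]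
    ring
  rw [h1, zero_mulVec, dotProduct_zero] at e4
  rw [e1, e2]
  linear_combination (-(1:ℝ) / 2) * e4 - (1 / 2 : ℝ) * h2

/-- **From the Lyapunov equation to the adjoint identities.** If `C` is invertible with inverse
`B` (`C B = B C = 1`) and `A C + C Aᵀ + Σ = 0`, then `AᵀB + BA + BΣB = 0` (multiply by `B` on both
sides) and `2 tr A + tr(ΣB) = 0` (multiply by `B` on the right and take the trace,
`tr(C Aᵀ B) = tr(Aᵀ)`). [folklore] -/
theorem lyapunov_inv_identities {A Q C B : Matrix ι ι ℝ} (hCB : C * B = 1) (hBC : B * C = 1)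
    (hlyap : A * C + C * Aᵀ + Q = 0) :
    Aᵀ * B + B * A + B * Q * B = 0 ∧ 2 * A.trace + (Q * B).trace = 0 := by
  constructor
  · have h := congrArg (fun M => B * M * B) hlyap
    have e1 : B * (A * C) * B = B * A := by
      rw [← Matrix.mul_assoc B A C, Matrix.mul_assoc (B * A) C B, hCB, Matrix.mul_one]
    have e2 : B * (C * Aᵀ) * B = Aᵀ * B := by
      rw [← Matrix.mul_assoc B C Aᵀ, hBC, Matrix.one_mul]
    simp only [Matrix.mul_zero, Matrix.zero_mul, Matrix.mul_add, Matrix.add_mul, e1, e2] at h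
    calc Aᵀ * B + B * A + B * Q * B = B * A + Aᵀ * B + B * Q * B := by abel
      _ = 0 := h
  · have h := congrArg (fun M => (M * B).trace) hlyap
    have e3 : (A * C * B).trace = A.trace := by
      rw [Matrix.mul_assoc A C B, hCB, Matrix.mul_one]
    have e4 : (C * Aᵀ * B).trace = A.trace := by
      rw [trace_mul_cycle C Aᵀ B, hBC, Matrix.one_mul, trace_transpose]
    simp only [Matrix.zero_mul, trace_zero, Matrix.add_mul, trace_add, e3, e4] at h
    linarith

end Algebra

section AdjointPoly

variable (ω₂ γ : ℝ)

/-- Trace of a matrix on `Fin N ⊕ Fin N` as the sum of the two diagonal block traces. [folklore] -/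
theorem trace_sum_index {R : Type*} [AddCommMonoid R] (M : Matrix (Fin N ⊕ Fin N) (Fin N ⊕ Fin N) R) :
    M.trace = (∑ i, M (Sum.inl i) (Sum.inl i)) + ∑ i, M (Sum.inr i) (Sum.inr i) := by
  simp [Matrix.trace, Fintype.sum_sum_type]

/-- `tr A = -γ ∑_i ([i=0]+[i=N-1])` for the drift matrix. [folklore] -/
theorem trace_driftMatrix (N : ℕ) : (driftMatrix ω₂ γ N).trace = -∑ i : Fin N, γ * bathMult N i := by
  rw [trace_sum_index]
  simp [driftMatrix, fromBlocks_apply₁₁, fromBlocks_apply₂₂, frictionMatrix, diagonal_apply_eq,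
    Finset.sum_neg_distrib]

/-- `tr(Σ B) = ∑_i 2γ T_i B_{p_i p_i}` for the noise matrix. [folklore] -/
theorem trace_noiseMatrix_mul (N : ℕ) (T_L T_R : ℝ) (B : Matrix (Fin N ⊕ Fin N) (Fin N ⊕ Fin N) ℝ) :
    (noiseMatrix γ N T_L T_R * B).trace =
      ∑ i : Fin N, 2 * γ * bathTemp N T_L T_R i * B (Sum.inr i) (Sum.inr i) := by
  rw [trace_sum_index]
  simp only [Matrix.mul_apply, Fintype.sum_sum_type, noiseMatrix, fromBlocks_apply₁₁,
    fromBlocks_apply₁₂, fromBlocks_apply₂₁, fromBlocks_apply₂₂, Matrix.zero_apply, zero_mul,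
    Finset.sum_const_zero, zero_add, diagonal_apply, ite_mul, Finset.sum_ite_eq, Finset.mem_univ,
    if_true]

/-- `(Bx♭) ⬝ Σ (Bx♭) = ∑_i 2γ T_i (Bx♭)_{p_i}²` for the noise matrix. [folklore] -/
theorem dotProduct_noiseMatrix_mulVec (N : ℕ) (T_L T_R : ℝ) (y : Fin N ⊕ Fin N → ℝ) :
    y ⬝ᵥ (noiseMatrix γ N T_L T_R *ᵥ y) =
      ∑ i : Fin N, 2 * γ * bathTemp N T_L T_R i * y (Sum.inr i) ^ 2 := by
  rw [noiseMatrix, fromBlocks_mulVec]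
  simp only [dotProduct, Fintype.sum_sum_type, Sum.elim_inl, Sum.elim_inr, zero_mulVec,
    Pi.zero_apply, zero_add, mul_zero, Finset.sum_const_zero, mulVec_diagonal, Function.comp_apply]
  exact Finset.sum_congr rfl fun i _ => by ring

/-- `(A x♭) ⬝ (B x♭) = ∑_i p_i (Bx♭)_{q_i} + ∑_i (-(Φq)_i - γ([i=0]+[i=N-1]) p_i) (Bx♭)_{p_i}` for
the drift matrix of the chain. [folklore] -/
theorem driftMatrix_mulVec_flat_dotProduct (x : PhaseSpace N) (y : Fin N ⊕ Fin N → ℝ) :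
    (driftMatrix ω₂ γ N *ᵥ flat x) ⬝ᵥ y =
      (∑ i, x.2 i * y (Sum.inl i)) +
        ∑ i, (-(forceMatrix ω₂ N *ᵥ x.1) i - γ * bathMult N i * x.2 i) * y (Sum.inr i) := by
  rw [driftMatrix, fromBlocks_mulVec, flat_comp_inl, flat_comp_inr]
  simp only [dotProduct, Fintype.sum_sum_type, Sum.elim_inl, Sum.elim_inr, Pi.add_apply, zero_mulVec,
    zero_add, one_mulVec, neg_mulVec, Pi.neg_apply, frictionMatrix, mulVec_diagonal]
  congr 1

/-- **The adjoint polynomial of the harmonic chain in matrix form**: for `P = pinnedChain ω₂ 0 0 γ`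
and any `B`,
`L*_B(x) = (A x♭)⬝(B x♭) - tr A - tr(Σ B)/2 + (Bx♭)⬝Σ(Bx♭)/2`
with `A = driftMatrix`, `Σ = noiseMatrix`. [folklore] -/
theorem adjointPoly_harmonic_eq (T_L T_R : ℝ) (B : Matrix (Fin N ⊕ Fin N) (Fin N ⊕ Fin N) ℝ)
    (x : PhaseSpace N) :
    (pinnedChain ω₂ 0 0 γ).adjointPoly B T_L T_R x =
      (driftMatrix ω₂ γ N *ᵥ flat x) ⬝ᵥ (B *ᵥ flat x) - (driftMatrix ω₂ γ N).trace -
        (noiseMatrix γ N T_L T_R * B).trace / 2 +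
          (B *ᵥ flat x) ⬝ᵥ (noiseMatrix γ N T_L T_R *ᵥ (B *ᵥ flat x)) / 2 := by
  set y := B *ᵥ flat x with hy
  rw [driftMatrix_mulVec_flat_dotProduct, trace_driftMatrix, trace_noiseMatrix_mul,
    dotProduct_noiseMatrix_mulVec, Finset.sum_div, Finset.sum_div, sub_neg_eq_add,
    ← Finset.sum_add_distrib, ← Finset.sum_add_distrib, ← Finset.sum_sub_distrib,
    ← Finset.sum_add_distrib]
  unfold OscillatorChain.adjointPoly
  simp only [pinnedChain_harmonic_partialQ_hamiltonian, pinnedChain_γ]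
  rw [Finset.mul_sum, ← Finset.sum_add_distrib]
  refine Finset.sum_congr rfl fun i _ => ?_
  simp only [bathMult, bathTemp, ← hy]
  split_ifs <;> ring

variable {ω₂ γ}

/-- **`L* ρ = 0` for the Gaussian with covariance `chainCov`.** For `ω₂, γ, T_L, T_R > 0` and
`B = (chainCov ω₂ γ N T_L T_R)⁻¹` the adjoint polynomial of the harmonic chain vanishes
identically: `½x♭ᵀ(AᵀB + BA + BΣB)x♭ - ½(2 tr A + tr ΣB) = 0` by the Lyapunov equation
`A C + C Aᵀ + Σ = 0`. [Bonetto–Lebowitz–Rey-Bellet 2000, §6.2; Dhar 2008, §3.1] [folklore] -/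
theorem adjointPoly_harmonic_eq_zero (hω : 0 < ω₂) (hγ : 0 < γ) (N : ℕ) {T_L T_R : ℝ}
    (hL : 0 < T_L) (hR : 0 < T_R) (x : PhaseSpace N) :
    (pinnedChain ω₂ 0 0 γ).adjointPoly (chainCov ω₂ γ N T_L T_R)⁻¹ T_L T_R x = 0 := by
  set C := chainCov ω₂ γ N T_L T_R with hC
  have hCpd : C.PosDef := chainCov_posDef hω hγ N hL hR
  have hunit : IsUnit C.det := (isUnit_iff_isUnit_det _).mp hCpd.isUnit
  have hCB : C * C⁻¹ = 1 := mul_nonsing_inv _ hunit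
  have hBC : C⁻¹ * C = 1 := nonsing_inv_mul _ hunit
  have hBt : (C⁻¹)ᵀ = C⁻¹ := by
    rw [transpose_nonsing_inv, chainCov_transpose hω hγ N T_L T_R]
  obtain ⟨h1, h2⟩ := lyapunov_inv_identities hCB hBC (chainCov_lyapunov hω hγ N T_L T_R)
  rw [adjointPoly_harmonic_eq]
  exact lyapunov_adjoint_form_eq_zero hBt h1 h2 (flat x)

end AdjointPoly

/-! ### The Gaussian NESS and its steady-state property -/

section NESS

variable (ω₂ γ : ℝ)

/-- **The non-equilibrium steady state of the harmonic chain** `pinnedChain ω₂ 0 0 γ` with `N`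
sites between Langevin baths at temperatures `T_L, T_R`: the centred Gaussian probability measure
on phase space with covariance `chainCov ω₂ γ N T_L T_R`, i.e. `Z⁻¹ exp(-½ x♭ᵀ C⁻¹ x♭) dq dp`
(Rieder–Lebowitz–Lieb 1967; Nakazawa 1970; "the stationary measure is Gaussian and one only needs
to compute the covariances", Bonetto–Lebowitz–Rey-Bellet 2000 §6.2). Meaningful for
`ω₂, γ, T_L, T_R > 0`. [cite: BonettoLebowitzReyBellet2000, §6.2] -/
def harmonicNESS (N : ℕ) (T_L T_R : ℝ) : Measure (PhaseSpace N) :=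
  gaussMeasure (chainCov ω₂ γ N T_L T_R)⁻¹

variable {ω₂ γ}

/-- The precision matrix `C⁻¹` of the NESS is positive definite. [folklore] -/
theorem posDef_chainCov_inv (hω : 0 < ω₂) (hγ : 0 < γ) (N : ℕ) {T_L T_R : ℝ} (hL : 0 < T_L)
    (hR : 0 < T_R) : ((chainCov ω₂ γ N T_L T_R)⁻¹).PosDef :=
  (chainCov_posDef hω hγ N hL hR).inv

/-- The NESS is a probability measure. [folklore] -/
theorem isProbabilityMeasure_harmonicNESS (hω : 0 < ω₂) (hγ : 0 < γ) (N : ℕ) {T_L T_R : ℝ}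
    (hL : 0 < T_L) (hR : 0 < T_R) : IsProbabilityMeasure (harmonicNESS ω₂ γ N T_L T_R) :=
  isProbabilityMeasure_gaussMeasure (posDef_chainCov_inv hω hγ N hL hR)

/-- `|j_i(x)| ≤ N (1 + |x♭|²)²` for the harmonic bond currents
`j_i = -(p_i + p_{i+1})(q_{i+1} - q_i)/2`. [folklore] -/
theorem abs_bondCurrent_harmonic_le (N : ℕ) (i : Fin N) (x : PhaseSpace N) :
    |(pinnedChain ω₂ 0 0 γ).bondCurrent N i x| ≤ N * (1 + flat x ⬝ᵥ flat x) ^ 2 := by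
  unfold OscillatorChain.bondCurrent
  have h0 : 0 ≤ flat x ⬝ᵥ flat x := flat_dotProduct_flat_nonneg x
  have hsq : ∀ a, flat x a * flat x a ≤ flat x ⬝ᵥ flat x := fun a =>
    Finset.single_le_sum (f := fun b => flat x b * flat x b) (fun b _ => mul_self_nonneg _)
      (Finset.mem_univ a)
  have hterm : ∀ j : Fin N, |(if j.val = i.val + 1 then
      -((x.2 i + x.2 j) / 2 * deriv (pinnedChain ω₂ 0 0 γ).V (x.1 j - x.1 i)) else 0)| ≤
      (1 + flat x ⬝ᵥ flat x) ^ 2 := by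
    intro j
    split_ifs with hj
    · rw [pinnedChain_harmonic_deriv_V, abs_neg, abs_mul]
      have hpi := hsq (Sum.inr i)
      have hpj := hsq (Sum.inr j)
      have hqi := hsq (Sum.inl i)
      have hqj := hsq (Sum.inl j)
      simp only [flat_inl, flat_inr] at hpi hpj hqi hqj
      have h1 : |(x.2 i + x.2 j) / 2| ≤ 1 + flat x ⬝ᵥ flat x := by
        rw [abs_le]
        constructor <;> nlinarith [sq_nonneg (x.2 i - 1), sq_nonneg (x.2 j - 1),
          sq_nonneg (x.2 i + 1), sq_nonneg (x.2 j + 1)]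
      have h2 : |x.1 j - x.1 i| ≤ 1 + flat x ⬝ᵥ flat x := by
        rw [abs_le]
        constructor <;> nlinarith [sq_nonneg (x.1 i - 1), sq_nonneg (x.1 j - 1),
          sq_nonneg (x.1 i + 1), sq_nonneg (x.1 j + 1)]
      calc |(x.2 i + x.2 j) / 2| * |x.1 j - x.1 i| ≤ (1 + flat x ⬝ᵥ flat x) * (1 + flat x ⬝ᵥ flat x) :=
          mul_le_mul h1 h2 (abs_nonneg _) (by linarith)
        _ = (1 + flat x ⬝ᵥ flat x) ^ 2 := by ring
    · rw [abs_zero]; positivity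
  calc |∑ j : Fin N, (if j.val = i.val + 1 then
          -((x.2 i + x.2 j) / 2 * deriv (pinnedChain ω₂ 0 0 γ).V (x.1 j - x.1 i)) else 0)|
      ≤ ∑ j : Fin N, |(if j.val = i.val + 1 then
          -((x.2 i + x.2 j) / 2 * deriv (pinnedChain ω₂ 0 0 γ).V (x.1 j - x.1 i)) else 0)| :=
        Finset.abs_sum_le_sum_abs _ _
    _ ≤ ∑ _j : Fin N, (1 + flat x ⬝ᵥ flat x) ^ 2 := Finset.sum_le_sum fun j _ => hterm j
    _ = N * (1 + flat x ⬝ᵥ flat x) ^ 2 := by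
        simp [Finset.sum_const, Finset.card_univ, Fintype.card_fin]

/-- **The Gaussian NESS is a weak steady state** of the harmonic chain: for `ω₂, γ > 0`, every `N`
and all `T_L, T_R > 0`, `harmonicNESS ω₂ γ N T_L T_R` is a probability measure with
`∫ L_{T_L,T_R} f dμ = 0` for all `f ∈ C_c^∞` and integrable bond currents
(`OscillatorChain.IsSteadyState`). [Bonetto–Lebowitz–Rey-Bellet 2000, §6.2 ("the resulting process
and thus also the stationary measure is Gaussian")] [cite: BonettoLebowitzReyBellet2000, §6.2] -/
theorem isSteadyState_harmonicNESS (hω : 0 < ω₂) (hγ : 0 < γ) (N : ℕ) {T_L T_R : ℝ}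
    (hL : 0 < T_L) (hR : 0 < T_R) :
    (pinnedChain ω₂ 0 0 γ).IsSteadyState N T_L T_R (harmonicNESS ω₂ γ N T_L T_R) := by
  have hB : ((chainCov ω₂ γ N T_L T_R)⁻¹).PosDef := posDef_chainCov_inv hω hγ N hL hR
  have hBt : ((chainCov ω₂ γ N T_L T_R)⁻¹)ᵀ = (chainCov ω₂ γ N T_L T_R)⁻¹ := transpose_eq_of_posDef hB
  refine ⟨isProbabilityMeasure_harmonicNESS hω hγ N hL hR, fun f hf hfc => ?_, fun i => ?_⟩
  · rw [harmonicNESS, integral_gaussMeasure,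
      (pinnedChain ω₂ 0 0 γ).integral_generator_mul_gaussDensity _ hBt
        (pinnedChain_contDiff_U ω₂ 0 0 γ) (pinnedChain_contDiff_V ω₂ 0 0 γ) T_L T_R
        (hf.of_le (by norm_cast)) hfc]
    simp [adjointPoly_harmonic_eq_zero hω hγ N hL hR]
  · exact integrable_gaussMeasure _ (integrable_mul_gaussDensity hB
      (pinnedChain_continuous_bondCurrent ω₂ 0 0 γ N i) (abs_bondCurrent_harmonic_le N i))

/-! ### Covariances and the mean bond currents of the NESS -/

/-- **The covariance of the NESS is `chainCov`**: `∫ x♭_a x♭_b dμ = C_{ab}`. [Dhar 2008, §3.1]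
[cite: Dhar2008, §3.1] -/
theorem integral_flat_mul_flat_harmonicNESS (hω : 0 < ω₂) (hγ : 0 < γ) (N : ℕ) {T_L T_R : ℝ}
    (hL : 0 < T_L) (hR : 0 < T_R) (a b : Fin N ⊕ Fin N) :
    ∫ x, flat x a * flat x b ∂(harmonicNESS ω₂ γ N T_L T_R) = chainCov ω₂ γ N T_L T_R a b := by
  have hCpd := chainCov_posDef hω hγ N hL hR
  have hunit : IsUnit (chainCov ω₂ γ N T_L T_R).det := (isUnit_iff_isUnit_det _).mp hCpd.isUnit
  exact integral_flat_mul_flat_gaussMeasure (posDef_chainCov_inv hω hγ N hL hR)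
    (mul_nonsing_inv _ hunit) (chainCov_transpose hω hγ N T_L T_R) a b

/-- The harmonic bond current of the bond `(n, n+1)` is the quadratic
`j_n = -(p_n + p_{n+1})(q_{n+1} - q_n)/2`. [Bonetto–Lebowitz–Rey-Bellet 2000, §5.2 eq. (23)]
[folklore] -/
theorem bondCurrent_harmonic_eq (n : ℕ) (hn : n + 1 < N) (x : PhaseSpace N) :
    (pinnedChain ω₂ 0 0 γ).bondCurrent N ⟨n, by omega⟩ x =
      -((x.2 ⟨n, by omega⟩ + x.2 ⟨n + 1, hn⟩) / 2 * (x.1 ⟨n + 1, hn⟩ - x.1 ⟨n, by omega⟩)) := by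
  unfold OscillatorChain.bondCurrent
  rw [Finset.sum_eq_single_of_mem (⟨n + 1, hn⟩ : Fin N) (Finset.mem_univ _)]
  · rw [if_pos rfl, pinnedChain_harmonic_deriv_V]
  · intro j _ hj
    rw [if_neg]
    intro h
    exact hj (Fin.ext h)

/-- **Mean bond current of the NESS = the position–momentum covariance**:
`∫ j_n dμ = ⟨q_n p_{n+1}⟩ = chainCov_{q_n, p_{n+1}}` (using `⟨q_i p_i⟩ = 0` and the antisymmetry
`⟨q_{n+1} p_n⟩ = -⟨q_n p_{n+1}⟩`). [Dhar 2008, §3.1 ("`J_{n→l} = -⟨(Φ_ln x_n) p_l/m_l⟩`")]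
[cite: Dhar2008, §3.1] -/
theorem integral_bondCurrent_harmonicNESS (hω : 0 < ω₂) (hγ : 0 < γ) {N : ℕ} {T_L T_R : ℝ}
    (hL : 0 < T_L) (hR : 0 < T_R) (n : ℕ) (hn : n + 1 < N) :
    ∫ x, (pinnedChain ω₂ 0 0 γ).bondCurrent N ⟨n, by omega⟩ x ∂(harmonicNESS ω₂ γ N T_L T_R) =
      chainCov ω₂ γ N T_L T_R (Sum.inl ⟨n, by omega⟩) (Sum.inr ⟨n + 1, hn⟩) := by
  set i : Fin N := ⟨n, by omega⟩ with hi
  set j : Fin N := ⟨n + 1, hn⟩ with hj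
  set μ := harmonicNESS ω₂ γ N T_L T_R with hμ
  have hB : ((chainCov ω₂ γ N T_L T_R)⁻¹).PosDef := posDef_chainCov_inv hω hγ N hL hR
  have hint : ∀ a b, Integrable (fun x => flat x a * flat x b) μ := fun a b =>
    integrable_gaussMeasure _ (integrable_flat_mul_flat_mul_gaussDensity hB a b)
  have hcov := integral_flat_mul_flat_harmonicNESS hω hγ N hL hR
  have hsplit : (fun x => (pinnedChain ω₂ 0 0 γ).bondCurrent N i x) = fun x =>
      (-(1:ℝ) / 2) * ((flat x (Sum.inr i) * flat x (Sum.inl j) - flat x (Sum.inr i) * flat x (Sum.inl i)) +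
        (flat x (Sum.inr j) * flat x (Sum.inl j) - flat x (Sum.inr j) * flat x (Sum.inl i))) := by
    funext x
    rw [hi, bondCurrent_harmonic_eq n hn x]
    simp only [flat_inl, flat_inr, hj]
    ring
  have hI1 : Integrable (fun x => flat x (Sum.inr i) * flat x (Sum.inl j) -
      flat x (Sum.inr i) * flat x (Sum.inl i)) μ := (hint _ _).sub (hint _ _)
  have hI2 : Integrable (fun x => flat x (Sum.inr j) * flat x (Sum.inl j) -
      flat x (Sum.inr j) * flat x (Sum.inl i)) μ := (hint _ _).sub (hint _ _)
  rw [hsplit, integral_const_mul, integral_add hI1 hI2,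
    integral_sub (hint _ _) (hint _ _), integral_sub (hint _ _) (hint _ _), hcov, hcov, hcov, hcov]
  have hsym : ∀ a b, chainCov ω₂ γ N T_L T_R (Sum.inr a) (Sum.inl b) =
      chainCov ω₂ γ N T_L T_R (Sum.inl b) (Sum.inr a) := fun a b => by
    have := congrFun (congrFun (chainCov_transpose hω hγ N T_L T_R) (Sum.inr a)) (Sum.inl b)
    rw [transpose_apply] at this
    exact this.symm
  rw [hsym, hsym, hsym, hsym, chainCov_inl_inr_self hω hγ, chainCov_inl_inr_self hω hγ,
    chainCov_inl_inr_antisymm hω hγ T_L T_R j i]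
  ring

/-- **Mean bond current `= c_N (T_L - T_R)`**: in the Gaussian NESS every bond `(n, n+1)` carries
the mean energy current `fluxCoeff ω₂ γ N · (T_L - T_R)`. [Bonetto–Lebowitz–Rey-Bellet 2000,
§6.2 ("non-vanishing covariances between position and momentum variables proportional to `δT`")]
[cite: BonettoLebowitzReyBellet2000, §6.2] -/
theorem integral_bondCurrent_harmonicNESS_eq_fluxCoeff (hω : 0 < ω₂) (hγ : 0 < γ) {N : ℕ}
    {T_L T_R : ℝ} (hL : 0 < T_L) (hR : 0 < T_R) (n : ℕ) (hn : n + 1 < N) :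
    ∫ x, (pinnedChain ω₂ 0 0 γ).bondCurrent N ⟨n, by omega⟩ x ∂(harmonicNESS ω₂ γ N T_L T_R) =
      fluxCoeff ω₂ γ N * (T_L - T_R) := by
  rw [integral_bondCurrent_harmonicNESS hω hγ hL hR n hn, chainCov_bond_eq_fluxCoeff hω hγ T_L T_R n hn]

/-- The same statement for a bond given as `i : Fin N` with `i + 1 < N`. [folklore] -/
theorem integral_bondCurrent_harmonicNESS_eq_fluxCoeff' (hω : 0 < ω₂) (hγ : 0 < γ) {N : ℕ}
    {T_L T_R : ℝ} (hL : 0 < T_L) (hR : 0 < T_R) (i : Fin N) (hi : i.val + 1 < N) :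
    ∫ x, (pinnedChain ω₂ 0 0 γ).bondCurrent N i x ∂(harmonicNESS ω₂ γ N T_L T_R) =
      fluxCoeff ω₂ γ N * (T_L - T_R) := by
  have h := integral_bondCurrent_harmonicNESS_eq_fluxCoeff hω hγ hL hR i.val hi
  have hi' : (⟨i.val, by omega⟩ : Fin N) = i := Fin.ext rfl
  rwa [hi'] at h

end NESS

end Literature.MathematicalPhysics.KineticTheory.HeatConduction
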